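import Summits.BirchSwinnertonDyer.BirchSwinnertonDyer.Theorems.AdditiveBranchIMCGordTwoRankZeroCongruence
import Literature.NumberTheory.EllipticCurves.ComplexMultiplicationBurungaleFlachProofs
import HarnessLib

/-!
# Crux `GordTwoRankZeroOffCaseOne` (items 19357 / 19244 / 19245), the EPW branch road: the base-case
# certificate (C2) READ OFF AN `L`-VALUE — the partner's `p`-twist is a rank-`0` pair whose algebraic
# `L`-value `L(E₁,1)/Ω_{E₁}` is a `p`-adic unit (sequel of `AdditiveBranchIMCGordTwoRankZeroCongruence`)

Cell `bsd-addord`, seat `bsd-addord-k1-c2` (D-0074 row B1), gen 2. HONEST FRAMING: as in the parent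
file — theorems only, every published input a named-fact binder (`hK`, `hEPW`, `hPal`, `hmod`, the
route's fact conjunctions), the certificates displayed and never asserted; closes nothing, books nothing.

WHAT. The parent file's certificate (C2) is «the constant term of `ϖ₁·L_p(f_{V₁}, α₁, ω^{(p−1)/2}, T)` has
`p`-adic norm `1`», an object of the tree's `p`-adic `L`-function vocabulary. By the branch constant term
(Mazur–Tate–Teitelbaum §I.14, tree theorem `constantCoeff_padicLFunctionBranch_half`: `= α₁⁻¹·∑_{a mod p}
(a/p)[a/p]⁺_{f}`) and Birch's formula with Pal's period theorem (tree theorem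
`entireLFunction_one_eq_of_twist`: `L(E₁,1) = ±ϖ₁·(∑ …)·Ω_{E₁}` for the `p`-twist `E₁ = C • V₁^{(p)}`,
`p ≡ 1 (mod 4)`), (C2) is EQUIVALENT to the elementary datum

  (C2′)  `E₁ := V₁ ⊗ (·/p)` (globally minimal model) has analytic rank `0` and `ord_p (L(E₁,1)/Ω_{E₁}) = 0`

— one rational number per partner, the rank-`0` BSD quotient every census row of the cell already carries
(`L(E,1)/Ω_E = #Ш_an·∏c_ℓ/#E(ℚ)²_tors` by definition of `#Ш_an`). So the road of the parent file reads:
for an additive pair `(E, p)` of cell (G-ord, `e = 2`), `p ≡ 1 (mod 4)`, `p ≥ 5`, `r_an(E) = 0`, with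
good ordinary twist model(s) `V`: IF some good ordinary `V₁` with `ρ_{V₁,pⁿ}` onto (all `n`) has
(C1) `V₁[p] ≅ V[p]` and (C2′) its own `p`-twist `E₁` is a rank-`0` pair with unit algebraic `L`-value,
THEN `ord_p #Ш(E)_an ≤ ord_p #Ш(E)` (`missingLowerBoundAt_rankZero_of_partner_LValueUnit`). In words: the
lower half of `BSD(E,p)` PROPAGATES from any mod-`p` congruent additive pair where it is trivial
(`p ∤ L(E₁,1)/Ω_{E₁}`) to the pairs where it has content — by Emerton–Pollack–Weston on the branch.

* `norm_constantCoeff_branch_eq_one_of_LValueUnit` — (C2′) ⟹ (C2) (even branch).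
* `branchCharIdealMuZeroEigen_of_katoComponent_of_LValueUnit` — the partner's 5.1.1 with `μ = 0` from
  `hK` + (C2′).
* `missingLowerBoundAt_rankZero_of_partner_LValueUnit` — the lower half at `(E, p)` from the route's
  facts, `hPal`, `hK`, `hEPW`, (C1) and (C2′).
The odd branch (`p ≡ 3 (mod 4)`) keeps the modular-symbol form of (C2) (the odd Birch identity carries the
extra rational factor `|u(C)|·c_∞(E₁)`, tree theorem `entireLFunction_one_eq_of_twist_neg`); not restated.

References: Emerton–Pollack–Weston 2006 Cor. 5.1.4 [EmertonPollackWeston2006]; Kato 2004 Thm. 17.4 (3)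
[Kato2004Asterisque]; Mazur–Tate–Teitelbaum 1986 §I.14 [MazurTateTeitelbaum1986Invent]; Pal 2012 Thm. 3.2
[Pal2012]; Delbourgo 1998 Prop. 4 [Delbourgo1998]; Miller 2011 Def. 1.1 [Miller2011LMS].
-/

set_option autoImplicit false
set_option linter.dupNamespace false

noncomputable section

open scoped Classical MatrixGroups ModularForm

open CongruenceSubgroup WeierstrassCurve NumberField IsDedekindDomain Rat.HeightOneSpectrum
  Literature.NumberTheory.EllipticCurves
  Literature.NumberTheory.EllipticCurves.ModularForms
  Literature.NumberTheory.EllipticCurves.Rank1Residual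
  Literature.NumberTheory.EllipticCurves.Rank1Residual.Typed
  Literature.NumberTheory.EllipticCurves.GreenbergVatsal2000
  Literature.NumberTheory.EllipticCurves.EmertonPollackWeston2006
  Literature.NumberTheory.GaloisRepresentations

namespace Summit.BirchSwinnertonDyer.BirchSwinnertonDyer.Theorems.AdditiveBranchIMCGordTwoRankZeroCongruence

open Summit.BirchSwinnertonDyer.Rank1Residual.Additive
open Summit.BirchSwinnertonDyer.BirchSwinnertonDyer.Theses.AdditiveBranchIMC
open Summit.BirchSwinnertonDyer.BirchSwinnertonDyer.Theorems.AdditiveBranchIMCGordTwoRankZeroTransport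

variable {p : ℕ} [hp : Fact p.Prime]

/-! ## (C2′) ⟹ (C2): a unit algebraic `L`-value of the partner's twist gives a unit branch constant term -/

/-- **(C2′) ⟹ (C2), even branch.** Let `p ≡ 1 (mod 4)`, `V₁/ℚ` globally minimal good ordinary at `p`,
`E₁ = C • V₁^{(p)}` a globally minimal curve ADDITIVE at `p` with `r_an(E₁) = 0` and
`L(E₁,1) = q·Ω_{E₁}`, `q ∈ ℚ`, `ord_p q = 0`. Then for every newform / period normalisation `(f, ϖ)` of
`V₁` (`ϖ·Ω_{V₁} = Ω⁺_f`) the constant term of `ϖ·L_p(f, α₁, ω^{(p−1)/2}, T)` has `p`-adic norm `1`: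
it is `ϖ·α₁⁻¹·∑(a/p)[a/p]⁺_f` (MTT §I.14), `α₁ ∈ ℤ_p^×`, and `ϖ·∑(a/p)[a/p]⁺_f = ±q` by Birch + Pal.
[cite: MazurTateTeitelbaum1986Invent, §I.14] [cite: Pal2012, Thm. 3.2] -/
theorem norm_constantCoeff_branch_eq_one_of_LValueUnit
    (hPal : Pal2012.thm32_sqrt_mul_realPeriodRat_twist_eq_of_prime_one_mod_four)
    (hmod : hasEntireLFunction_rat) (hp1 : p % 4 = 1)
    (V₁ E₁ : WeierstrassCurve ℚ) [V₁.IsElliptic] [V₁.IsGloballyMinimal] [E₁.IsElliptic]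
    [E₁.IsGloballyMinimal] (hCW : ∃ C : VariableChange ℚ, C • V₁.quadraticTwist (p : ℚ) = E₁)
    (hV : GoodOrd V₁ p) (hadd : Addv E₁ p) (hr : E₁.analyticRank = 0)
    (hL : ∃ q : ℚ, E₁.entireLFunction 1 = (q : ℂ) * (E₁.realPeriodRat : ℂ) ∧ padicValRat p q = 0)
    {N : ℕ} [NeZero N] (f : CuspForm (Gamma0 N) 2) (hf : IsNewformOf V₁ f) (ϖ : ℚ)
    (hϖ : (ϖ : ℝ) * V₁.realPeriodRat = plusPeriod f) :
    ‖PowerSeries.constantCoeff (PowerSeries.C (ϖ : ℚ_[p]) *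
      padicLFunctionBranch f ((unitRoot V₁ p : ℤ_[p]) : ℚ_[p]) (p / 2))‖ = 1 := by
  have hp2 : p ≠ 2 := by rintro rfl; norm_num at hp1
  have hord : IsOrdinaryAt V₁ p := hV
  -- Birch + Pal: `L(E₁,1) = ε ϖ S Ω`
  obtain ⟨ε, hε, hLε⟩ := entireLFunction_one_eq_of_twist p hPal hmod hp1 V₁ E₁ hCW (Or.inl hV.1) hadd hf ϖ hϖ
  obtain ⟨q, hq, hvq⟩ := hL
  have hL0 : E₁.entireLFunction 1 ≠ 0 := (E₁.analyticRank_eq_zero_iff_holds (hmod E₁)).mp hr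
  have hΩ : (E₁.realPeriodRat : ℂ) ≠ 0 := by exact_mod_cast (E₁.realPeriodRat_pos_holds).ne'
  -- so `q = ε ϖ S`
  have hqε : q = ε * (ϖ * legendrePlusSymbolSum f p) := by
    have h1 : ((q : ℂ)) = ((ε * (ϖ * legendrePlusSymbolSum f p) : ℚ) : ℂ) :=
      mul_right_cancel₀ hΩ (hq.symm.trans hLε)
    exact_mod_cast h1
  have hq0 : q ≠ 0 := by
    rintro rfl
    exact hL0 (by rw [hq]; simp)
  -- `ord_p (ϖ S) = ord_p q = 0`
  have hϖS0 : (ϖ * legendrePlusSymbolSum f p : ℚ) ≠ 0 := by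
    intro hz; exact hq0 (by rw [hqε, hz, mul_zero])
  have hε0 : ε ≠ 0 := by rcases hε with rfl | rfl <;> norm_num
  have hval : padicValRat p (ϖ * legendrePlusSymbolSum f p) = 0 := by
    have hvε : padicValRat p ε = 0 := by
      rcases hε with rfl | rfl
      · exact padicValRat.one
      · rw [← padicValRat.neg, neg_neg]; exact padicValRat.one
    have := hvq
    rw [hqε, padicValRat.mul hε0 hϖS0, hvε, zero_add] at this
    exact this
  have hnormϖS : ‖((ϖ * legendrePlusSymbolSum f p : ℚ) : ℚ_[p])‖ = 1 := by
    rw [Padic.eq_padicNorm, padicNorm.eq_zpow_of_nonzero hϖS0, hval, neg_zero, zpow_zero]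
    push_cast; rfl
  -- the unit root has norm one
  obtain ⟨-, hαunit⟩ := unitRoot_spec_holds V₁ p hord
  have hα : ‖((unitRoot V₁ p : ℤ_[p]) : ℚ_[p])‖ = 1 := by
    rw [PadicInt.padic_norm_e_of_padicInt]; exact PadicInt.isUnit_iff.mp hαunit
  rw [map_mul, PowerSeries.constantCoeff_C, constantCoeff_padicLFunctionBranch_half p hp2 V₁ hord hf,
    mul_left_comm, norm_mul, norm_inv, hα, inv_one, one_mul]
  have : (ϖ : ℚ_[p]) * (legendrePlusSymbolSum f p : ℚ_[p]) = ((ϖ * legendrePlusSymbolSum f p : ℚ) : ℚ_[p]) := by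
    push_cast; rfl
  rw [this, hnormϖS]

/-- **The partner's 5.1.1 with `μ = 0` on the branch from Kato and (C2′)** (`p ≡ 1 (mod 4)`): `V₁` good
ordinary with `ρ_{V₁,pⁿ}` onto for all `n`, its globally minimal `p`-twist `E₁` additive at `p` of analytic
rank `0` with `ord_p (L(E₁,1)/Ω_{E₁}) = 0` ⟹ `BranchCharIdealMuZeroEigen V₁ p` (parent file §1 with the
certificate (C2) supplied by `norm_constantCoeff_branch_eq_one_of_LValueUnit`).
[cite: Kato2004Asterisque, Thm. 17.4 (3) (p. 273)] [cite: EmertonPollackWeston2006, statement 5.1.1 (arXiv p30)]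
[cite: MazurTateTeitelbaum1986Invent, §I.14] [cite: Pal2012, Thm. 3.2] -/
theorem branchCharIdealMuZeroEigen_of_katoComponent_of_LValueUnit
    (hK : Kato2004.charIdeal_dvd_padicLFunctionBranch_component_of_surjective)
    (hPal : Pal2012.thm32_sqrt_mul_realPeriodRat_twist_eq_of_prime_one_mod_four)
    (hmod : hasEntireLFunction_rat) (hp1 : p % 4 = 1)
    (V₁ E₁ : WeierstrassCurve ℚ) [V₁.IsElliptic] [V₁.IsGloballyMinimal] [E₁.IsElliptic]
    [E₁.IsGloballyMinimal] (hCW : ∃ C : VariableChange ℚ, C • V₁.quadraticTwist (p : ℚ) = E₁)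
    (hV : GoodOrd V₁ p) (hsurj : ∀ n : ℕ, V₁.HasSurjectiveModNGaloisRep (p ^ n : ℕ))
    (hadd : Addv E₁ p) (hr : E₁.analyticRank = 0)
    (hL : ∃ q : ℚ, E₁.entireLFunction 1 = (q : ℂ) * (E₁.realPeriodRat : ℂ) ∧ padicValRat p q = 0) :
    BranchCharIdealMuZeroEigen V₁ p := by
  have heven : Even (p / 2) := ⟨p / 4, by omega⟩
  refine branchCharIdealMuZeroEigen_of_katoComponent_of_unit hK V₁ hV hsurj ?_
  intro N _ f hf ϖ hϖ
  rw [if_pos heven] at hϖ ⊢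
  exact norm_constantCoeff_branch_eq_one_of_LValueUnit hPal hmod hp1 V₁ E₁ hCW hV hadd hr hL f hf ϖ hϖ

/-! ## The lower half at `(E, p)` from a partner certified by (C1) + (C2′) -/

/-- **Cell (G-ord, `e = 2`), `p ≡ 1 (mod 4)`, `p ≥ 5`, `r_an(E) = 0`: `ord_p #Ш(E)_an ≤ ord_p #Ш(E)` from
the route's facts, Pal, Kato's component reading, EPW's branch transfer, and a PARTNER certified by
(C1) + (C2′).** The partner: `V₁` globally minimal, good ordinary at `p`, `ρ_{V₁,pⁿ}` onto for all `n`,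
with its globally minimal `p`-twist `E₁` (additive at `p`) of analytic rank `0` and
`ord_p (L(E₁,1)/Ω_{E₁}) = 0`; (C1): a `Γ_ℚ`-equivariant `V₁[p] ≃ V[p]` for the good ordinary twist
models `V` of `E`. I.e. the lower half PROPAGATES along a mod-`p` congruence from an additive pair where
it is trivial to the pair `(E, p)`. CONDITIONAL on the displayed facts and certificates; closes nothing.
[cite: EmertonPollackWeston2006, Cor. 5.1.4 (arXiv p30)] [cite: Kato2004Asterisque, Thm. 17.4 (3) (p. 273)]
[cite: Pal2012, Thm. 3.2] [cite: Delbourgo1998, Prop. 4 (p. 144)] [cite: Miller2011LMS, Def. 1.1] -/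
theorem missingLowerBoundAt_rankZero_of_partner_LValueUnit {W : WeierstrassCurve ℚ} [W.IsElliptic]
    [W.IsGloballyMinimal] (hP : PrintedFacts) (hR : ReadingFacts)
    (hPal : Pal2012.thm32_sqrt_mul_realPeriodRat_twist_eq_of_prime_one_mod_four)
    (hK : Kato2004.charIdeal_dvd_padicLFunctionBranch_component_of_surjective)
    (hEPW : EmertonPollackWeston2006.cor514_branchTransfer_of_torsionIso)
    (hc : N10.CellGordTwo W p) (hp1 : p % 4 = 1) (hp5 : 5 ≤ p) (hr : W.analyticRank = 0)
    (V₁ E₁ : WeierstrassCurve ℚ) [V₁.IsElliptic] [V₁.IsGloballyMinimal] [E₁.IsElliptic]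
    [E₁.IsGloballyMinimal] (hCW₁ : ∃ C : VariableChange ℚ, C • V₁.quadraticTwist (p : ℚ) = E₁)
    (hV₁ : GoodOrd V₁ p) (hirr₁ : V₁.HasIrreducibleModPGaloisRep p)
    (hsurj₁ : ∀ n : ℕ, V₁.HasSurjectiveModNGaloisRep (p ^ n : ℕ))
    (hadd₁ : Addv E₁ p) (hr₁ : E₁.analyticRank = 0)
    (hL₁ : ∃ q : ℚ, E₁.entireLFunction 1 = (q : ℂ) * (E₁.realPeriodRat : ℂ) ∧ padicValRat p q = 0)
    (hiso : ∀ (V : WeierstrassCurve ℚ) [V.IsElliptic] [V.IsGloballyMinimal],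
      (∃ C : VariableChange ℚ, C • V.quadraticTwist (p : ℚ) = W) → GoodOrd V p →
      ∃ e : geomTorsion V₁ (p : ℤ) ≃+ geomTorsion V (p : ℤ),
        ∀ (σ : Field.absoluteGaloisGroup ℚ) (P : geomTorsion V₁ (p : ℤ)), e (σ • P) = σ • e P) :
    MissingLowerBoundAt W p := by
  obtain ⟨-, -, -, -, hGZK, hmod, hmodD, -⟩ := hP
  obtain ⟨-, -, -, -, hDelG⟩ := hR
  exact missingLowerBoundAt_rankZero_of_branchTransfer hEPW hDelG hPal hGZK hmod hmodD hc hp1 hp5 hr V₁ hV₁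
    hirr₁ (branchCharIdealMuZeroEigen_of_katoComponent_of_LValueUnit hK hPal hmod hp1 V₁ E₁ hCW₁ hV₁ hsurj₁
      hadd₁ hr₁ hL₁) hiso

end Summit.BirchSwinnertonDyer.BirchSwinnertonDyer.Theorems.AdditiveBranchIMCGordTwoRankZeroCongruence

end
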